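import Summits.AtomisticToContinuum.FouriersLaw.Theorems.OddSectorIrreversibilityCorrectorTheorySmooth

/-!
# `HiddenChargeMazur.StaticKubo`, line `birth`, stub `stub_poissonValue` — the value-class Poisson solution

Helper file (`--supports stmt-AtomisticToContinuum-13510`, crux decl `HiddenChargeMazur.StaticKubo`,
registered stub `stub_poissonValue` of the skeleton `Cruxes/StaticKubo/Lines/birth.lean`, rev 2).

For the pinned anharmonic chain `pinnedChain ω₂ lam β γ` (all parameters `> 0`), every `T > 0` and
`N ≥ 2`: there is `F ∈ C²(PhaseSpace N)` with a VALUE bound `|F| ≤ C e^{θH}` for some `θ < 1/(2T)`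
solving the Poisson equation `generator N T T F = -∑_i bondCurrent N i` pointwise.

Proof: the witness is the smooth Kubo corrector `u` of the tree
(`OddSectorIrreversibility.Corrector.corrector_smooth`: `u ∈ C^∞`, `u = ∫_{(0,∞)} P_t J dt` a.e.,
`L_{T,T} u = -J` pointwise, `|u| ≤ K e^{ϑH}` for every `0 < ϑ < 1/T`), taken at `ϑ = 1/(4T) < 1/(2T)`.
[Cuneo–Eckmann–Hairer–Rey-Bellet 2018, Thm 2.13; Hörmander 1967, Thm 1.1; Kundu–Dhar–Narayan 2009]
-/

noncomputable section

open Literature.MathematicalPhysics.KineticTheory.HeatConduction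

namespace Summit.AtomisticToContinuum.FouriersLaw.Cruxes.StaticKubo.Birth.Stubs

/-- **stub 1a — `stub_poissonValue` (Poisson equation `L_{T,T} F = −J`, value class), proved.**
For `pinnedChain ω₂ lam β γ` (all `> 0`), every `T > 0` and `N ≥ 2` there is `F ∈ C²(PhaseSpace N)` with
`|F z| ≤ C e^{θ H_N(z)}` for some `C` and `θ < 1/(2T)`, solving `generator N T T F = −Σ_i bondCurrent N i`
pointwise — the smooth Kubo corrector `u = ∫₀^∞ P_t J dt` of the tree (`corrector_smooth`) at
`ϑ = 1/(4T)`. [Cuneo–Eckmann–Hairer–Rey-Bellet 2018, Thm 2.13; Kundu–Dhar–Narayan 2009] -/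
theorem stub_poissonValue :
    ∀ ω₂ lam β γ : ℝ, 0 < ω₂ → 0 < lam → 0 < β → 0 < γ → ∀ P : Literature.MathematicalPhysics.KineticTheory.HeatConduction.OscillatorChain, P = Literature.MathematicalPhysics.KineticTheory.HeatConduction.pinnedChain ω₂ lam β γ → ∀ T : ℝ, 0 < T → ∀ N : ℕ, 2 ≤ N → ∃ F : Literature.MathematicalPhysics.KineticTheory.HeatConduction.PhaseSpace N → ℝ, ContDiff ℝ 2 F ∧ (∃ C θ : ℝ, θ < 1 / (2 * T) ∧ ∀ z : Literature.MathematicalPhysics.KineticTheory.HeatConduction.PhaseSpace N, |F z| ≤ C * Real.exp (θ * P.hamiltonian N z)) ∧ (∀ z : Literature.MathematicalPhysics.KineticTheory.HeatConduction.PhaseSpace N, P.generator N T T F z = -(∑ i : Fin N, P.bondCurrent N i z)) := by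
  intro ω₂ lam β γ hω hl hβ hγ P hP T hT N hN
  subst hP
  have hN' : 0 < N := by omega
  obtain ⟨u, hu, -, hLu, hbound⟩ :=
    Summit.AtomisticToContinuum.FouriersLaw.Theorems.OddSectorIrreversibility.Corrector.corrector_smooth
      hω hl hβ hγ hT hN'
  have hϑ₀ : 0 < 1 / (4 * T) := by positivity
  have hϑ₁ : 1 / (4 * T) < 1 / T := by
    rw [div_lt_div_iff_of_pos_left one_pos (by positivity) hT]
    linarith
  obtain ⟨K, -, hK⟩ := hbound (1 / (4 * T)) hϑ₀ hϑ₁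
  refine ⟨u, hu.of_le (by norm_cast), ⟨K, 1 / (4 * T), ?_, hK⟩, hLu⟩
  rw [div_lt_div_iff_of_pos_left one_pos (by positivity) (by positivity)]
  linarith
end Summit.AtomisticToContinuum.FouriersLaw.Cruxes.StaticKubo.Birth.Stubs

end
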